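import Mathlib
import HarnessLib
import Literature.ModelTheory.FiniteModelTheory.StructCkEquiv
import Summits.ValiantsHypothesis.ValiantsHypothesis.Theorems.SymmetryDialAffinePebble
import Summits.ValiantsHypothesis.ValiantsHypothesis.Theorems.SymmetryDialDisalignedCFI
import Summits.ValiantsHypothesis.ValiantsHypothesis.Theorems.SymmetryDialDisalignedCFIShear

/-!
# Symmetry dial — strategy introduction for the disaligned compact-CFI game (NODE-g9 §A.3 (S3), lens 1, g9)

The game half of the affine-shear lemma, reduced to its combinatorial core.

§1 (generic, any relational language `L`): **strategy introduction by a parametrised family of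
bijections with an invariant** (`structCkEquiv_of_invariant`).  Duplicator's positions are the GRAPH
POSITIONS `graphPos (e φ) s` of a bijection `e φ : M ≃ N` on a Spoiler-side position `s`; if an invariant
`Good φ s` holds initially, can be re-established after every lift-and-place (with a new parameter `φ'`
whose bijection agrees with the old one on the pebbles left on the board), and makes the graph position a
partial isomorphism, then `M ≡_{C^k} N`.  A graph position of a bijection respects equality
automatically, so partial isomorphism reduces to relation transfer on pebbled tuples
(`isPartialIso_graphPos`).

§2 (affine matrix structures): for the SHEAR BIJECTION `shearSum L c = shear (L + c) ⊕ dualShear L` of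
`𝔽₂^{d₀+r} ⊔ 𝔽₂^{d₀+r}` (points ⊔ duals) the relations `pt, dl, aff, inc` transfer unconditionally
(kernel (S1): `shear_aff`, `pair_dualShear_shear_add`) and `mat` transfers between `cfiMat D S t` and
`cfiMat D S t'` exactly on the point pairs where `t` and the retwist `t' + ∂(L + c)` give the same bit
(kernel (S2): `cfiMat_shear`).  Hence (`isPartialIso_shear`): a shear graph position is a partial
isomorphism `𝔄(cfiMat D S t) ⇀ 𝔄(cfiMat D S t')` as soon as no two pebbled points span an edge on which
`t` and `t' + ∂(L+c)` differ — the criterion (I2) of NODE-g9 §A.3 — and (`affinePebbleEquiv_of_shearInvariant`)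
the `k`-pebble game `AffinePebbleEquiv k` reduces to exhibiting an invariant on (affine shear, position)
with that clear-pebbled-pairs property which survives every lift-and-place.  What remains for the full
lemma (S4) is the linear algebra showing that the certificate `COND_k(D)` supplies such an invariant.
-/

set_option linter.dupNamespace false

namespace Summit.ValiantsHypothesis.ValiantsHypothesis.Theorems.SymmetryDialShearStrategy

open Literature.ModelTheory.FiniteModelTheory
open FirstOrder FirstOrder.Language FirstOrder.Language.Structure
open SymmetryDialAffinePebble (V pair Laff AffRel RelHolds affStr AffinePebbleEquiv)
open SymmetryDialDisalignedCFI (Design cfiMat)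
open SymmetryDialDisalignedCFIShear (shear shearFun shearFun_shearFun cobd cfiMat_shear dualShear
  pair_dualShear_shear_add shear_aff)

universe u v w w'

/-! ## §1 Graph positions and strategy introduction -/

section Generic

variable {k : ℕ} {M : Type w} {N : Type w'}

/-- The GRAPH POSITION of a map `e` on a Spoiler-side position `s`: pebble `j` sits on `(a, e a)` when
`s j = some a`. -/
def graphPos (e : M → N) (s : Fin k → Option M) : PebblePosition k M N :=
  fun j => (s j).map fun a => (a, e a)

/-- The graph position of the empty Spoiler-side position is the empty position. -/
theorem graphPos_none (e : M → N) : graphPos e (fun _ : Fin k => (none : Option M)) = PebblePosition.empty := by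
  funext j; rfl

/-- Pebbled pairs of a graph position: `(a, b)` is pebbled iff `a` carries a pebble and `b = e a`. -/
theorem pebbled_graphPos_iff (e : M → N) (s : Fin k → Option M) (a : M) (b : N) :
    (graphPos e s).Pebbled a b ↔ (∃ i, s i = some a) ∧ b = e a := by
  constructor
  · rintro ⟨i, hi⟩
    unfold graphPos at hi
    cases hs : s i with
    | none => rw [hs] at hi; simp at hi
    | some a' =>
      rw [hs] at hi
      simp only [Option.map_some, Option.some.injEq, Prod.mk.injEq] at hi
      obtain ⟨rfl, rfl⟩ := hi
      exact ⟨⟨i, hs⟩, rfl⟩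
  · rintro ⟨⟨i, hi⟩, rfl⟩
    exact ⟨i, by simp [graphPos, hi]⟩

/-- Lift-and-place on a graph position is the graph position of lift-and-place, for any map agreeing with
the old one on the pebbles that stay. -/
theorem update_graphPos (e e' : M → N) (s : Fin k → Option M) (i : Fin k) (a : M)
    (hagree : ∀ j, j ≠ i → ∀ a', s j = some a' → e' a' = e a') :
    Function.update (graphPos e s) i (some (a, e' a)) = graphPos e' (Function.update s i (some a)) := by
  funext j
  by_cases hji : j = i
  · subst hji
    simp [graphPos]
  · rw [Function.update_of_ne hji]
    simp only [graphPos, Function.update_of_ne hji]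
    cases hs : s j with
    | none => rfl
    | some a' => simp [hagree j hji a' hs]

variable {L : FirstOrder.Language.{u, v}} [L.Structure M] [L.Structure N]

/-- **A graph position of a bijection is a partial isomorphism iff relations transfer on pebbled tuples**
(equality compatibility is automatic). -/
theorem isPartialIso_graphPos (e : M ≃ N) (s : Fin k → Option M)
    (hrel : ∀ {n : ℕ} (R : L.Relations n) (a : Fin n → M), (∀ j, ∃ i, s i = some (a j)) →
      (RelMap R a ↔ RelMap R (e ∘ a))) :
    (graphPos e s).IsPartialIso L := by
  refine ⟨fun a a' b b' hab ha'b' => ?_, fun n R a b hab => ?_⟩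
  · rw [((pebbled_graphPos_iff e s a b).1 hab).2, ((pebbled_graphPos_iff e s a' b').1 ha'b').2]
    exact e.injective.eq_iff.symm
  · have hb : b = e ∘ a := funext fun j => ((pebbled_graphPos_iff e s (a j) (b j)).1 (hab j)).2
    rw [hb]
    exact hrel R a fun j => ((pebbled_graphPos_iff e s (a j) (b j)).1 (hab j)).1

/-- **Strategy introduction by an invariant on a parametrised family of bijections.**  If `Good φ s`
holds for the empty position, is re-established after every lift of pebble `i` and placement on any
`a` by some parameter `φ'` whose bijection agrees with `e φ` on the pebbles `j ≠ i` left on the board,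
and makes the graph position of `e φ` on `s` a partial isomorphism, then Duplicator wins the bijective
`k`-pebble game: `M ≡_{C^k} N`. -/
theorem structCkEquiv_of_invariant {Φ : Type*} (e : Φ → M ≃ N) (Good : Φ → (Fin k → Option M) → Prop)
    (h0 : ∃ φ, Good φ fun _ => none)
    (hmove : ∀ φ s, Good φ s → ∀ i : Fin k, ∃ φ',
      (∀ j, j ≠ i → ∀ a, s j = some a → e φ' a = e φ a) ∧ ∀ a, Good φ' (Function.update s i (some a)))
    (hiso : ∀ φ s, Good φ s → (graphPos (e φ) s).IsPartialIso L) :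
    StructCkEquiv L k M N := by
  refine ⟨{ positions := {p | ∃ φ s, Good φ s ∧ p = graphPos (e φ) s}, empty_mem := ?_, move := ?_ }, ?_⟩
  · obtain ⟨φ, hφ⟩ := h0
    exact ⟨φ, _, hφ, (graphPos_none (e φ)).symm⟩
  · rintro p ⟨φ, s, hs, rfl⟩ i
    obtain ⟨φ', hagree, hgood⟩ := hmove φ s hs i
    refine ⟨e φ', fun a => ⟨φ', Function.update s i (some a), hgood a, ?_⟩⟩
    exact update_graphPos (e φ) (e φ') s i a hagree
  · rintro p ⟨φ, s, hs, rfl⟩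
    exact hiso φ s hs

end Generic

/-! ## §2 The shear bijection of an affine matrix structure and relation transfer -/

variable {d₀ r δ : ℕ}

/-- The dual shear is an involution. -/
theorem dualShear_dualShear (L : V d₀ → V r) (ξ : V (d₀ + r)) : dualShear L (dualShear L ξ) = ξ := by
  unfold dualShear
  rw [SymmetryDialDisalignedCFIDisplacement.base_append, SymmetryDialDisalignedCFIDisplacement.fib_append,
    add_assoc, SymmetryDialAffineOrbits.add_self, add_zero, SymmetryDialDisalignedCFIShear.append_base_fib]

/-- The dual shear as a permutation of `𝔽₂^{d₀+r}`. -/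
def dualShearEquiv (L : V d₀ → V r) : V (d₀ + r) ≃ V (d₀ + r) :=
  ⟨dualShear L, dualShear L, dualShear_dualShear L, dualShear_dualShear L⟩

/-- **The shear bijection** of the two-sorted universe: points by the affine shear `x ↦ (v, a + L v + c)`,
duals by the dual shear `(α, β) ↦ (α + Lᵀ β, β)`. -/
def shearSum (L : V d₀ → V r) (c : V r) : (V (d₀ + r) ⊕ V (d₀ + r)) ≃ (V (d₀ + r) ⊕ V (d₀ + r)) :=
  Equiv.sumCongr (shear fun v => L v + c) (dualShearEquiv L)

/-- `shearSum` on a point. -/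
@[simp] theorem shearSum_inl (L : V d₀ → V r) (c : V r) (x : V (d₀ + r)) :
    shearSum L c (.inl x) = .inl (shear (fun v => L v + c) x) := rfl

/-- `shearSum` on a dual. -/
@[simp] theorem shearSum_inr (L : V d₀ → V r) (c : V r) (ξ : V (d₀ + r)) :
    shearSum L c (.inr ξ) = .inr (dualShear L ξ) := rfl

/-- Preimage description of points under `shearSum` (the point shear is an involution). -/
theorem shearSum_eq_inl_iff (L : V d₀ → V r) (c : V r) (z : V (d₀ + r) ⊕ V (d₀ + r)) (a : V (d₀ + r)) :
    shearSum L c z = .inl a ↔ z = .inl (shear (fun v => L v + c) a) := by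
  cases z with
  | inl x =>
    simp only [shearSum_inl, Sum.inl.injEq, SymmetryDialDisalignedCFIShear.shear_apply]
    constructor
    · rintro rfl; rw [shearFun_shearFun]
    · rintro rfl; rw [shearFun_shearFun]
  | inr ξ => simp

/-- Preimage description of duals under `shearSum` (the dual shear is an involution). -/
theorem shearSum_eq_inr_iff (L : V d₀ → V r) (c : V r) (z : V (d₀ + r) ⊕ V (d₀ + r)) (ξ : V (d₀ + r)) :
    shearSum L c z = .inr ξ ↔ z = .inr (dualShear L ξ) := by
  cases z with
  | inl x => simp
  | inr η =>
    simp only [shearSum_inr, Sum.inr.injEq]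
    constructor
    · rintro rfl; rw [dualShear_dualShear]
    · rintro rfl; rw [dualShear_dualShear]

/-- **Relation transfer under the shear bijection (S1)+(S2).**  For additive `L`: the relations
`pt, dl, aff, inc` of `𝔄(A)` and `𝔄(B)` correspond under `shearSum L c` for ANY matrices `A, B`; the
relation `mat` corresponds between `A = cfiMat D S t` and `B = cfiMat D S t'` on a tuple whose points
`x, y` all satisfy `cfiMat D S t (x, y) = cfiMat D S (t' + ∂(L+c)) (x, y)`. -/
theorem relHolds_shearSum_iff (D : Design d₀ r δ) (hinj : Function.Injective D.gen) (S : V d₀ → V r → Bool)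
    (t t' : V d₀ → V d₀ → Fin 2) (L : V d₀ → V r) (hL : ∀ v w, L (v + w) = L v + L w) (c : V r)
    {n : ℕ} (R : AffRel n) (xs : Fin n → V (d₀ + r) ⊕ V (d₀ + r))
    (hclear : ∀ (j j' : Fin n) (x y : V (d₀ + r)), xs j = .inl x → xs j' = .inl y →
      cfiMat D S t (x, y) = cfiMat D S (fun v w => t' v w + cobd D (fun v => L v + c) v w) (x, y)) :
    RelHolds (cfiMat D S t) R xs ↔ RelHolds (cfiMat D S t') R (shearSum L c ∘ xs) := by
  cases R with
  | pt =>
    show (∃ a, xs 0 = .inl a) ↔ (∃ a, shearSum L c (xs 0) = .inl a)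
    simp only [shearSum_eq_inl_iff]
    exact ⟨fun ⟨a, ha⟩ => ⟨shear (fun v => L v + c) a, by simpa [shearFun_shearFun] using ha⟩,
      fun ⟨a, ha⟩ => ⟨_, ha⟩⟩
  | dl =>
    show (∃ ξ, xs 0 = .inr ξ) ↔ (∃ ξ, shearSum L c (xs 0) = .inr ξ)
    simp only [shearSum_eq_inr_iff]
    exact ⟨fun ⟨ξ, hξ⟩ => ⟨dualShear L ξ, by simpa [dualShear_dualShear] using hξ⟩, fun ⟨ξ, hξ⟩ => ⟨_, hξ⟩⟩
  | aff =>
    show (∃ a b c' e : V (d₀ + r), xs 0 = .inl a ∧ xs 1 = .inl b ∧ xs 2 = .inl c' ∧ xs 3 = .inl e ∧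
        a + b + c' = e) ↔ (∃ a b c' e : V (d₀ + r), shearSum L c (xs 0) = .inl a ∧
        shearSum L c (xs 1) = .inl b ∧ shearSum L c (xs 2) = .inl c' ∧ shearSum L c (xs 3) = .inl e ∧
        a + b + c' = e)
    simp only [shearSum_eq_inl_iff]
    constructor
    · rintro ⟨a, b, c', e, h0, h1, h2, h3, hsum⟩
      refine ⟨shear (fun v => L v + c) a, shear (fun v => L v + c) b, shear (fun v => L v + c) c',
        shear (fun v => L v + c) e, ?_, ?_, ?_, ?_, (shear_aff L hL c a b c' e).2 hsum⟩ <;>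
        simpa [shearFun_shearFun]
    · rintro ⟨a, b, c', e, h0, h1, h2, h3, hsum⟩
      exact ⟨_, _, _, _, h0, h1, h2, h3, (shear_aff L hL c a b c' e).2 hsum⟩
  | inc =>
    show (∃ ξ a b : V (d₀ + r), xs 0 = .inr ξ ∧ xs 1 = .inl a ∧ xs 2 = .inl b ∧ pair ξ (a + b) = 0) ↔
      (∃ ξ a b : V (d₀ + r), shearSum L c (xs 0) = .inr ξ ∧ shearSum L c (xs 1) = .inl a ∧
        shearSum L c (xs 2) = .inl b ∧ pair ξ (a + b) = 0)
    simp only [shearSum_eq_inl_iff, shearSum_eq_inr_iff]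
    constructor
    · rintro ⟨ξ, a, b, h0, h1, h2, hp⟩
      refine ⟨dualShear L ξ, shear (fun v => L v + c) a, shear (fun v => L v + c) b, ?_, ?_, ?_, ?_⟩
      · simpa [dualShear_dualShear] using h0
      · simpa [shearFun_shearFun] using h1
      · simpa [shearFun_shearFun] using h2
      · rw [pair_dualShear_shear_add L hL c]; exact hp
    · rintro ⟨ξ, a, b, h0, h1, h2, hp⟩
      refine ⟨_, _, _, h0, h1, h2, ?_⟩
      rw [pair_dualShear_shear_add L hL c]; exact hp
  | mat =>
    show (∃ a b : V (d₀ + r), xs 0 = .inl a ∧ xs 1 = .inl b ∧ cfiMat D S t (a, b) = true) ↔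
      (∃ a b : V (d₀ + r), shearSum L c (xs 0) = .inl a ∧ shearSum L c (xs 1) = .inl b ∧
        cfiMat D S t' (a, b) = true)
    simp only [shearSum_eq_inl_iff]
    constructor
    · rintro ⟨a, b, h0, h1, hm⟩
      refine ⟨shear (fun v => L v + c) a, shear (fun v => L v + c) b, ?_, ?_, ?_⟩
      · simpa [shearFun_shearFun] using h0
      · simpa [shearFun_shearFun] using h1
      · rw [cfiMat_shear D hinj, ← hclear 0 1 a b h0 h1]; exact hm
    · rintro ⟨a, b, h0, h1, hm⟩
      refine ⟨_, _, h0, h1, ?_⟩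
      rw [hclear 0 1 _ _ h0 h1, ← cfiMat_shear D hinj]
      simpa [SymmetryDialDisalignedCFIShear.shear_apply, shearFun_shearFun] using hm

/-- **(I2) ⇒ partial isomorphism.**  A shear graph position between `𝔄(cfiMat D S t)` and
`𝔄(cfiMat D S t')` is a partial isomorphism as soon as every pair of pebbled POINTS `x, y` satisfies
`cfiMat D S t (x, y) = cfiMat D S (t' + ∂(L+c)) (x, y)` (no pebbled pair spans a dirty edge). -/
theorem isPartialIso_shear {k : ℕ} (D : Design d₀ r δ) (hinj : Function.Injective D.gen)
    (S : V d₀ → V r → Bool) (t t' : V d₀ → V d₀ → Fin 2) (L : V d₀ → V r) (hL : ∀ v w, L (v + w) = L v + L w)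
    (c : V r) (s : Fin k → Option (V (d₀ + r) ⊕ V (d₀ + r)))
    (hclear : ∀ x y : V (d₀ + r), (∃ i, s i = some (.inl x)) → (∃ i, s i = some (.inl y)) →
      cfiMat D S t (x, y) = cfiMat D S (fun v w => t' v w + cobd D (fun v => L v + c) v w) (x, y)) :
    @PebblePosition.IsPartialIso k _ _ Laff (affStr (cfiMat D S t)) (affStr (cfiMat D S t'))
      (graphPos (shearSum L c) s) := by
  refine @isPartialIso_graphPos k _ _ Laff (affStr (cfiMat D S t)) (affStr (cfiMat D S t')) (shearSum L c) s ?_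
  intro n R xs hxs
  exact relHolds_shearSum_iff D hinj S t t' L hL c R xs fun j j' x y hj hj' =>
    hclear x y (hj ▸ hxs j) (hj' ▸ hxs j')

/-- Parameters of Duplicator's shears: an additive `L : 𝔽₂^{d₀} → 𝔽₂^r` and a translation `c ∈ 𝔽₂^r`. -/
abbrev ShearParam (d₀ r : ℕ) : Type := {L : V d₀ → V r // ∀ v w, L (v + w) = L v + L w} × V r

/-- **(S3) The game reduced to an invariant.**  To win the `k`-pebble bijective game on
`𝔄(cfiMat D S t)` versus `𝔄(cfiMat D S t')` it suffices to give an invariant `Good (L, c) s` on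
(affine shear, Spoiler-side position) which holds at the start, implies that no two pebbled points span
an edge where `t` and `t' + ∂(L+c)` differ, and can be re-established after every lift-and-place by a
shear agreeing with the old one on the pebbles that stay.  (The certificate `COND_k(D)` of NODE-g9 §B.2
is designed to supply exactly such an invariant; that linear algebra is the remaining half of (S4).) -/
theorem affinePebbleEquiv_of_shearInvariant {k : ℕ} (D : Design d₀ r δ) (hinj : Function.Injective D.gen)
    (S : V d₀ → V r → Bool) (t t' : V d₀ → V d₀ → Fin 2)
    (Good : ShearParam d₀ r → (Fin k → Option (V (d₀ + r) ⊕ V (d₀ + r))) → Prop)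
    (h0 : ∃ φ, Good φ fun _ => none)
    (hclear : ∀ φ s, Good φ s → ∀ x y : V (d₀ + r), (∃ i, s i = some (.inl x)) → (∃ i, s i = some (.inl y)) →
      cfiMat D S t (x, y) = cfiMat D S (fun v w => t' v w + cobd D (fun v => φ.1.1 v + φ.2) v w) (x, y))
    (hmove : ∀ φ s, Good φ s → ∀ i : Fin k, ∃ φ' : ShearParam d₀ r,
      (∀ j, j ≠ i → ∀ z, s j = some z → shearSum φ'.1.1 φ'.2 z = shearSum φ.1.1 φ.2 z) ∧
      ∀ z, Good φ' (Function.update s i (some z))) :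
    AffinePebbleEquiv k (d₀ + r) (cfiMat D S t) (cfiMat D S t') :=
  @structCkEquiv_of_invariant k _ _ Laff (affStr (cfiMat D S t)) (affStr (cfiMat D S t')) (ShearParam d₀ r)
    (fun φ => shearSum φ.1.1 φ.2) Good h0 hmove fun φ s hs =>
      isPartialIso_shear D hinj S t t' φ.1.1 φ.1.2 φ.2 s (hclear φ s hs)

end Summit.ValiantsHypothesis.ValiantsHypothesis.Theorems.SymmetryDialShearStrategy
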